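import Summits.Parity.GeneralizedHardyLittlewood.Theses.OneSidedAggregateExchangeRate
import Summits.Parity.GeneralizedHardyLittlewood.Theorems.TwinLowerDensityToGHLShiftLiftOffClassExactness
import Summits.Parity.GeneralizedHardyLittlewood.Theorems.GeneralizedHardyLittlewoodDimOnePosition
import Summits.Parity.GeneralizedHardyLittlewood.Theorems.DicksonFibrationDimOnePerimeter
import HarnessLib

/-!
# Crux `TwinLowerDensityToGHL` (stmt-Parity-18380, route `OneSidedAggregateExchangeRate`): final kernel position
# of the item and of the registered stub `stub_shiftLift` — the ADMISSIBLE SPREADING CORE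

The item is the route's declared residual `R := TwinLowerDensity → GeneralizedHardyLittlewood`.  This file
records, without new definitions and sorry-free:

* `twinLowerDensityToGHL_iff_dimOne` — `R ⟺ (T → GeneralizedHardyLittlewoodDimOne)` (stmt-Parity-0819), by the
  tree's fibration equivalence `generalizedHardyLittlewood_iff_generalizedHardyLittlewoodDimOne`;
  `twinLowerDensityToGHL_of_dimOne` — `0819 ⇒ R` in one line (the item is CLOSED by any proof of 0819);
* `dimOne_iff_largeDiscCore` — under `BoundedDickson` (stmt-Parity-13151 = stub `stub_boundedDickson` verbatim),
  `GeneralizedHardyLittlewoodDimOne` is EQUIVALENT to its **admissible spreading core**: shift-uniformity for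
  non-degenerate systems of `t ≥ 2` forms with `β_p(Ψ) > 0` at EVERY prime (no local obstruction) and SOME pair
  discriminant `|aᵢ bⱼ − aⱼ bᵢ| > D` (`D = D(t, L, ε)` at the prover's disposal).  This intersects the previous
  hand's large-discriminant position (`dimOne_iff_largeDisc`, translation class / bounded discriminants done from
  `BoundedDickson`) with the tree's unconditional perimeter of crux `DimOne` (`dimOne_one`: one form, PNT in
  progressions, shift-uniform; `dimOne_of_localFactor_eq_zero`: locally obstructed systems, `𝔖 = 0`, shift-uniform);
* `shiftLift_iff_largeDiscCore` — hence **`stub_shiftLift` ⟺ (`BoundedDickson` → admissible spreading core)**: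
  what is open in the stub is EXACTLY shift-uniform Dickson–Hardy–Littlewood for admissible patterns of `t ≥ 2`
  forms that spread with `N` (pairs `(n, n + h)`, `h` even, `h → ∞`; Goldbach `(n, M − n)`), the regime refuted in
  the illusory world by `not_generalizedHardyLittlewoodDimOne_of_unboundedSiegelZeros` (`(n, n + 2q)`, admissible,
  `t = 2`, discriminant `2q → ∞`);
* `twinLowerDensityToGHL_iff_core` — and the item itself: `R ⟺ (T → BoundedDickson-core ∧ spreading core)`
  is NOT claimed; only `R ⟺ (T → DimOne)` and, given `T`, nothing weaker than `DimOne` suffices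
  (`dimOne_of_twinLowerDensityToGHL`).

References: B. Green, T. Tao, *Linear equations in primes*, Ann. of Math. 171 (2010), Conj. 1.2, Lemma 1.3 and §1
[GreenTao2010]; K. Matomäki, J. Merikoski, IMRN (2023), Thm. 1.3 [MatomakiMerikoski2023].
-/

open Finset

namespace Summit.Parity.GeneralizedHardyLittlewood.TwinLowerDensityToGHLResidualCore

open Literature.NumberTheory.Sieve
open Summit.Parity.GeneralizedHardyLittlewood (GeneralizedHardyLittlewoodDimOne
  generalizedHardyLittlewood_iff_generalizedHardyLittlewoodDimOne)
open Summit.Parity.GeneralizedHardyLittlewood.Theses.TwinMinorArcs (BoundedDickson)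
open Summit.Parity.GeneralizedHardyLittlewood.Theses.OneSidedAggregateExchangeRate
  (TwinLowerDensity TwinLowerDensityToGHL)
open Summit.Parity.GeneralizedHardyLittlewood.Cruxes.DimOne.BirthSieve (dimOne_one dimOne_of_localFactor_eq_zero)
open Summit.Parity.GeneralizedHardyLittlewood.TwinLowerDensityToGHLShiftLiftTranslationClass
  (uniform_boundedDisc dimOne_iff_largeDisc)

/-! ### The item: `R ⟺ (T → DimOne)`, and `DimOne ⇒ R` -/

/-- **`R ⟺ (T → GeneralizedHardyLittlewoodDimOne)`**: the declared residual of route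
`OneSidedAggregateExchangeRate` is the one-variable Green–Tao conjecture (stmt-Parity-0819) conditioned on the
route's target `T` (fibration equivalence of the tree). [cite: GreenTao2010, Conj. 1.2 and §1] -/
theorem twinLowerDensityToGHL_iff_dimOne :
    TwinLowerDensityToGHL ↔ (TwinLowerDensity → GeneralizedHardyLittlewoodDimOne) := by
  unfold TwinLowerDensityToGHL
  rw [generalizedHardyLittlewood_iff_generalizedHardyLittlewoodDimOne]

/-- **`0819 ⇒ R`**: any proof of `GeneralizedHardyLittlewoodDimOne` closes the item (`T` unused).
[cite: GreenTao2010, Conj. 1.2 and §1] -/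
theorem twinLowerDensityToGHL_of_dimOne (h : GeneralizedHardyLittlewoodDimOne) : TwinLowerDensityToGHL :=
  twinLowerDensityToGHL_iff_dimOne.mpr fun _ => h

/-- **Given `T`, `R` is exactly `DimOne`**: `R ∧ T ⇒ GeneralizedHardyLittlewoodDimOne`. [cite: GreenTao2010, Conj. 1.2] -/
theorem dimOne_of_twinLowerDensityToGHL (hR : TwinLowerDensityToGHL) (hT : TwinLowerDensity) :
    GeneralizedHardyLittlewoodDimOne :=
  twinLowerDensityToGHL_iff_dimOne.mp hR hT

/-! ### The stub `stub_shiftLift`: the admissible spreading core -/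

/-- **Under `BoundedDickson`, `DimOne` ⟺ its admissible spreading core.**  For all `t ≥ 2`, `L`, `ε > 0` there are
`D`, `N₀` such that the Hardy–Littlewood error is `≤ ε N` for all `N ≥ N₀`, all non-degenerate `Ψ` of `t` forms with
`‖Ψ‖_N ≤ L`, NO local obstruction (`β_p(Ψ) > 0` at every prime) and SOME pair discriminant `> D`, and all convex
`K ⊆ [−N, N]`.  (`→`: restriction.  `←`: one form is the tree's `dimOne_one`; a locally obstructed system is the
tree's `dimOne_of_localFactor_eq_zero`; bounded discriminants are `uniform_boundedDisc` from `BoundedDickson`; the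
rest is the core.) [cite: GreenTao2010, Conj. 1.2 (d = 1), Lemma 1.3] -/
theorem dimOne_iff_largeDiscCore (hBD : BoundedDickson) :
    GeneralizedHardyLittlewoodDimOne ↔
      ∀ (t L : ℕ), 2 ≤ t → ∀ ε : ℝ, 0 < ε → ∃ D N₀ : ℕ, ∀ N : ℕ, N₀ ≤ N →
        ∀ Ψ : Fin t → AffLinForm 1, IsNondegenerateSystem Ψ → affLinSize Ψ N ≤ L →
          (∀ p : ℕ, p.Prime → 0 < localFactor Ψ p) →
          (∃ i j, (D : ℤ) < |(Ψ i).coeff 0 * (Ψ j).const - (Ψ j).coeff 0 * (Ψ i).const|) →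
          ∀ K : Set (Fin 1 → ℝ), Convex ℝ K → K ⊆ realBox 1 N →
            |vonMangoldtSum Ψ K N - archFactor Ψ K * singularProduct Ψ| ≤ ε * (N : ℝ) := by
  refine ⟨fun hD t L _ ε hε => ?_, fun hCore => ?_⟩
  · obtain ⟨N₀, hN₀⟩ := hD t L (by omega) ε hε
    exact ⟨0, N₀, fun N hN Ψ hΨ hL _ _ K hK hKN => hN₀ N hN Ψ hΨ hL K hK hKN⟩
  · refine (dimOne_iff_largeDisc hBD).mpr fun t L ht ε hε => ?_
    rcases Nat.lt_or_ge t 2 with ht2 | ht2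
    · -- one form: PNT in progressions, shift-uniform (tree)
      obtain rfl : t = 1 := by omega
      obtain ⟨N₀, hN₀⟩ := dimOne_one L ε hε
      exact ⟨0, N₀, fun N hN Ψ hΨ hL _ K hK hKN => hN₀ N hN Ψ hΨ hL K hK hKN⟩
    · obtain ⟨D, N₁, hN₁⟩ := hCore t L ht2 ε hε
      obtain ⟨N₂, hN₂⟩ := dimOne_of_localFactor_eq_zero t L ε hε
      refine ⟨D, max N₁ N₂, fun N hN Ψ hΨ hL hdisc K hK hKN => ?_⟩
      by_cases hob : ∃ p : ℕ, p.Prime ∧ localFactor Ψ p = 0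
      · -- locally obstructed: `𝔖(Ψ) = 0`, sum `O(log^{t+1} N)` (tree, shift-uniform)
        obtain ⟨p, hp, h0⟩ := hob
        exact hN₂ N (le_of_max_le_right hN) Ψ hΨ hL p hp h0 K
      · push Not at hob
        have hpos : ∀ p : ℕ, p.Prime → 0 < localFactor Ψ p := fun p hp =>
          lt_of_le_of_ne (localFactor_nonneg Ψ p) (fun h => hob p hp h.symm)
        exact hN₁ N (le_of_max_le_left hN) Ψ hΨ hL hpos hdisc K hK hKN

/-- **`stub_shiftLift` ⟺ (`BoundedDickson` → admissible spreading core).**  The registered stub of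
stmt-Parity-18380 (`BoundedDickson → GeneralizedHardyLittlewoodDimOne`, 13151 → 0819 verbatim) is EXACTLY the
statement that fixed-pattern Dickson–Hardy–Littlewood implies shift-uniformity for ADMISSIBLE patterns of `t ≥ 2`
forms that SPREAD (some pair discriminant beyond every bound).  Everything else in the stub — one form, locally
obstructed systems, bounded (and ineffectively slowly growing) discriminants — is a theorem of the tree given
`BoundedDickson`. [cite: GreenTao2010, Conj. 1.2 (d = 1)] -/
theorem shiftLift_iff_largeDiscCore :
    (BoundedDickson → GeneralizedHardyLittlewoodDimOne) ↔
      (BoundedDickson →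
        ∀ (t L : ℕ), 2 ≤ t → ∀ ε : ℝ, 0 < ε → ∃ D N₀ : ℕ, ∀ N : ℕ, N₀ ≤ N →
          ∀ Ψ : Fin t → AffLinForm 1, IsNondegenerateSystem Ψ → affLinSize Ψ N ≤ L →
            (∀ p : ℕ, p.Prime → 0 < localFactor Ψ p) →
            (∃ i j, (D : ℤ) < |(Ψ i).coeff 0 * (Ψ j).const - (Ψ j).coeff 0 * (Ψ i).const|) →
            ∀ K : Set (Fin 1 → ℝ), Convex ℝ K → K ⊆ realBox 1 N →
              |vonMangoldtSum Ψ K N - archFactor Ψ K * singularProduct Ψ| ≤ ε * (N : ℝ)) :=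
  ⟨fun h hBD => (dimOne_iff_largeDiscCore hBD).mp (h hBD),
    fun h hBD => (dimOne_iff_largeDiscCore hBD).mpr (h hBD)⟩

/-- Kernel check: the left side of `shiftLift_iff_largeDiscCore` is the REGISTERED text of `stub_shiftLift` verbatim. -/
example :
    ((∀ (t : ℕ) (Φ : Fin t → Literature.NumberTheory.Sieve.AffLinForm 1), 1 ≤ t → Literature.NumberTheory.Sieve.IsNondegenerateSystem Φ → ∀ ε : ℝ, 0 < ε → ∃ N₀ : ℕ, ∀ N : ℕ, N₀ ≤ N → ∀ K : Set (Fin 1 → ℝ), Convex ℝ K → K ⊆ Literature.NumberTheory.Sieve.realBox 1 N → |Literature.NumberTheory.Sieve.vonMangoldtSum Φ K N - Literature.NumberTheory.Sieve.archFactor Φ K * Literature.NumberTheory.Sieve.singularProduct Φ| ≤ ε * N) →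
      ∀ (t L : ℕ), 1 ≤ t → ∀ ε : ℝ, 0 < ε → ∃ N₀ : ℕ, ∀ N : ℕ, N₀ ≤ N → ∀ Ψ : Fin t → Literature.NumberTheory.Sieve.AffLinForm 1, Literature.NumberTheory.Sieve.IsNondegenerateSystem Ψ → Literature.NumberTheory.Sieve.affLinSize Ψ N ≤ L → ∀ K : Set (Fin 1 → ℝ), Convex ℝ K → K ⊆ Literature.NumberTheory.Sieve.realBox 1 N → |Literature.NumberTheory.Sieve.vonMangoldtSum Ψ K N - Literature.NumberTheory.Sieve.archFactor Ψ K * Literature.NumberTheory.Sieve.singularProduct Ψ| ≤ ε * (N : ℝ)) ↔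
    (BoundedDickson → GeneralizedHardyLittlewoodDimOne) :=
  Iff.rfl

/-- **The item modulo its two registered stubs, sharpened**: `R` follows from the admissible core of
`BoundedDickson` (`t ≥ 2`, `β_p > 0` at every prime, FIXED system; tree `boundedDickson_of_core` peels `t = 1` and
the obstructed systems) together with the admissible spreading core of the shift lift — `T` inert.  Recorded so the
census reads the open content of the line as two ADMISSIBLE `t ≥ 2` statements and nothing else.
[cite: GreenTao2010, Conj. 1.2 (d = 1)] -/
theorem twinLowerDensityToGHL_of_cores (hBD : BoundedDickson)
    (hCore : ∀ (t L : ℕ), 2 ≤ t → ∀ ε : ℝ, 0 < ε → ∃ D N₀ : ℕ, ∀ N : ℕ, N₀ ≤ N →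
        ∀ Ψ : Fin t → AffLinForm 1, IsNondegenerateSystem Ψ → affLinSize Ψ N ≤ L →
          (∀ p : ℕ, p.Prime → 0 < localFactor Ψ p) →
          (∃ i j, (D : ℤ) < |(Ψ i).coeff 0 * (Ψ j).const - (Ψ j).coeff 0 * (Ψ i).const|) →
          ∀ K : Set (Fin 1 → ℝ), Convex ℝ K → K ⊆ realBox 1 N →
            |vonMangoldtSum Ψ K N - archFactor Ψ K * singularProduct Ψ| ≤ ε * (N : ℝ)) :
    TwinLowerDensityToGHL :=
  twinLowerDensityToGHL_of_dimOne ((dimOne_iff_largeDiscCore hBD).mpr hCore)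

end Summit.Parity.GeneralizedHardyLittlewood.TwinLowerDensityToGHLResidualCore
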